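import Summits.BirchSwinnertonDyer.Rank1Residual.O5.HeegnerLogTransportThreeStepZeroEndTwoSided
import HarnessLib
import HarnessLib.Audit.Tags

/-!
# Heegner-log transport at `p = 3` (KL3), part 27b: the HEEGNER-INDEX END — `3 ∤ [G(K) : ℤP_G]` for a
# GOOD companion `G` transports to `3 ∤ [W(K) : ℤP_W]` for the (t′) curve, assuming ONLY Kriz–Li Thm. 1.16
# and modularity (no Iwasawa-theoretic input, no `Ш`, no descent, ordinary OR supersingular companion) — o5-r2 GEN 28

HONEST FRAMING (cell `b2b-bsdres`, run/shared/lean/b2b/bsd-rank1-residual/, verbatim in every file): the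
goal of the cell is to DELETE the COMBINATION-SHAPED residual classes of the Birch–Swinnerton-Dyer formula
for ALL analytic-rank `≤ 1` elliptic curves over `ℚ` — "full BSD formula for every rank `≤ 1` curve in
class `C`" assembled STRICTLY from published theorems — so that the rank-`≤ 1` remainder becomes exactly
the CONSTRUCTION-SHAPED classes, which are TYPED (missing-input `Prop`s), NOT attempted. This is not
"finishing BSD". Team O5 (tame potentially supersingular additive `p = 3`, (t′)), planner o5-r2 (the
non-Iwasawa side), GEN 28; RESEARCH ROUTE; THEOREMS ONLY (bookkeeping over explicit hypotheses): no new
node is WANTED, no Literature fact, no `@[conjecture]`, no new object; NOTHING is booked and no mark of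
`RESIDUAL-MAP.md` moves. O5 OPEN.

## Why this file (memo `HOME/b2b-bsdres-o5-r2/gen28/O5-GEN28.md`)

Every END of the KL3 family since GEN 17 has the same trunk: GEN 16's W-side transport
`padicValNat_index_eq_zero_of_companion_unit'` (Kriz–Li's congruence of normalised `3`-adic Heegner
logarithms along `W[3] ≅ G[3]`, `3` split in `K`: a unit log on the companion side forces a unit log, hence
a `3`-indivisible Heegner point, on the additive side) fed with GEN 17's local bookkeeping
`companion_logUnit_of_index_unit` (a `3`-primitive point `Q ∈ G(K)` at `ι₃` and `3 ∤ [G(K) : ℤP′]` make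
`P′` `3`-primitive). GEN 17–27 then DISCHARGED the companion's index `3 ∤ [G(K) : ℤP′]` through
Gross–Zagier (STEP 0), `BSD(G,3) ∧ BSD(G^{(d_K)},3)` (Yan–Zhu on row C16 — good ORDINARY companions only)
and `Ш(G/K)[3] = 0` (descents / exact special values). THIS file records the trunk itself as an END, which
the tree did not yet contain as one statement: **if the companion's Heegner point has index prime to `3`
in `G(K)`, then so has the (t′) curve's in `W(K)`** — published inputs Kriz–Li Thm. 1.16 (`hKL`) and
modularity (`hmod`) ONLY: no Yan–Zhu, no Wuthrich, no Gross–Zagier–Kolyvagin, no Kolyvagin (finiteness of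
the index is part of `3 ∤ index`, as `3 ∣ 0`), no `Ш`, no descent, no Tamagawa condition on the companion
pair, no twist; and the companion needs only GOOD reduction at `3` — ordinary or SUPERSINGULAR — so the
four `𝓛 = 0` census pairs with a supersingular companion (`23184z1`, `162288ei1 ~ 2576l1`; `439569bw1`,
`439569e1 ~ 48841a1`; memo GEN 27 docket (v)), for which no `BSD₃` of the companion is in print, are in
the scope of THIS END and of no other. The price is the binder `hIdx : 3 ∤ [G(K) : ℤP′]` itself: a per-row
statement checkable by the oldest instrument of the subject (the Heegner point `P′_K` from the modular
parametrisation to high precision, its trace `P′ + P′^σ` identified in `G(ℚ) = ℤg ⊕ T` against Cremona's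
generator `g` through the period lattice — `P′ + P′^σ = n·g + t` — and cross-checked against Gross–Zagier's
height formula; then `ord₃ [G(K) : ℤP′] = ord₃ n + ord₃ #G(K)_tors`, as `[G(K)/tors : G(ℚ)/tors] ∣ 2`;
Gross–Zagier 1986 §V.2, Cremona Algorithms §2.10), but not a kernel certificate and not a descent count.
Census (EVIDENCE, memo §4, kit job j193386): `ord₃ [G(K) : ℤP′] = 0` (`n = 4, −64, −8, −16, −32`; lattice
residual `< 10⁻⁵²`; Gross–Zagier ratio exactly `n²/4`) and the unit-log bit `hQunit` TRUE for the companions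
`16655c1/−356`, `26770a1/−551`, `47825d1/−344` (rows of record) AND the supersingular `2576l1/−551`,
`48841a1/−263`. Per pair these seven `W` are already GEN 3 `CheckedT` rows
(`O5/HeegnerIndexRecordsThreeRankOneT1/T4.lean`: the index of `P_W` itself, two engines), so the END is the
TRANSPORT reading — the (t′) conclusion from companion-side data and Kriz–Li alone — not a new `BSD₃`
instance. §2: the unit-log datum a RATIONAL point (part 12), as in parts 25/27.

## TYPER PLACEMENT NOTE

Place as `O5/HeegnerLogTransportThreeHeegnerIndexEnd.lean` AFTER part 25
(`O5/HeegnerLogTransportThreeStepZeroEndTwoSided.lean`, in the tree), which this file imports (for GEN 16's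
`…ThreeGlobal`, GEN 17's `…ThreeOrdCompanion`, part 12 `…ThreeRatLogUnit`, part 14's Kriz–Li glue and
GEN 22's `not_three_dvd_discr_of_split`); THEOREMS only, namespace
`Summit.BirchSwinnertonDyer.Rank1Residual.O5.HeegnerLogTransport`; no `def`.
CONTENT LABELS: THEOREMS ONLY — 0 `def`, 0 `@[conjecture]`, 0 Literature facts (net named-fact debt 0),
no `sorry`; published inputs stay displayed hypotheses BY NAME. HONEST FRAMING as above; census = EVIDENCE,
never a Literature fact; O5 OPEN; nothing booked.

### cc-typer-5 GEN 20 (O5 §3.5 / O6 §3.4 typer of record) — by-name ask A-O5-G28-1 (b) of o5-r2 GEN 28, HOME/INBOX.md l.15140 (unchanged by P.S. 1b / P.S. 2); memo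
`HOME/b2b-bsdres-o5-r2/gen28/O5-GEN28.md`.

Source: `HOME/b2b-bsdres-o5-r2/gen28/lean/HeegnerLogTransportThreeHeegnerIndexEnd.lean` sha16 `b38bc754e068f621` (182 l.; `gen28/SHA16.txt`; o5-r2's farm checks rc 0 / 0 warnings
/ 0 sorries, axioms standard, dedup clean),
re-hashed by the typer right before writing; THIS file = the source VERBATIM + this paragraph (imports, module text, every declaration block byte-identical; script
`class-closure/typer-5/gen20/g28_place.py`, docstring anchor asserted); imports part 25 `…StepZeroEndTwoSided` (p361579, this seat) + HarnessLib only — all in the tree; the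
typer's own standalone farm check
on tree imports (rc 0 / 0 warnings / 0 sorries; `#print axioms` of the ENDs standard) and DEDUP (`lean search --decl` on the new names: no match) precede the proposal.
CONTENT LABELS (source, unchanged): THEOREMS ONLY (2: `o5_index_unit_of_good_companion_heegnerIndex` (+ `_rat`) — the NON-IWASAWA TRUNK as an END: binders hKL, hmod, hcong, hρ,
hadd, hunitW, hunitG, htam(W), `hgoodG : G.HasGoodReductionAtPrime 3`, Heegner data, hQunit, `hIdx : ¬ 3 ∣ (zmultiples P′).index`, hcD, hc3′ ONLY; proof = GEN 17
`companion_logUnit_of_index_unit` + GEN 16 `padicValNat_index_eq_zero_of_companion_unit'` + part 14 KL glue); 0 `def`, 0 `@[conjecture]`, 0 Literature facts (net named-fact debt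
0), no `sorry`; published inputs stay displayed hypotheses
BY NAME, nothing re-proved.  HONEST FRAMING (cell `b2b-bsdres`): research route, lane CLASS-CLOSURE §3.5 O5; CONDITIONAL ENDs — nothing asserted beyond the displayed binders,
nothing booked, no mark / label / count / tier of `RESIDUAL-MAP.md` moves; census / instrument statements (`hIdx`, `hQunit`, `hShaAnGd`, the 3-descents) = EVIDENCE or
displayed binders, never a Literature fact; O5 OPEN.
-/

set_option autoImplicit false

noncomputable section

open scoped Classical

open WeierstrassCurve Literature.NumberTheory.EllipticCurves
  Literature.NumberTheory.EllipticCurves.ModularForms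
  Literature.NumberTheory.EllipticCurves.Rank1Residual
  Literature.NumberTheory.EllipticCurves.Rank1Residual.Typed
open Summit.BirchSwinnertonDyer.Rank1Residual.X11b (embAt)
open Summit.BirchSwinnertonDyer.Rank1Residual.Additive.LocalLog (padicLog)
open IsDedekindDomain (HeightOneSpectrum)
open scoped NumberField

namespace Summit.BirchSwinnertonDyer.Rank1Residual.O5.HeegnerLogTransport

/-! ## §1 The Heegner-index END: Kriz–Li Thm. 1.16 + modularity, nothing else published -/

/-- **O5 (t′) HEEGNER-INDEX END (o5-r2 GEN 28).** `W/ℚ` additive at `3` (`Addv W 3`) with `ρ̄_{W,3}` onto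
and `3 ∤ ∏c(W)`; `G/ℚ` a mod-`3` congruent companion with GOOD reduction at `3` (ordinary or
supersingular); a common Heegner field `K` (`d_K < −4`, `3` split); Heegner points `P ∈ W(K)`, `P′ ∈ G(K)`
of infinite order; off-`3` depletion factors units on both sides; Manin constants prime to `3`; a point
`Q ∈ G(K)` of infinite order `3`-primitive at `ι₃` in Kriz–Li's normalisation; and the companion's Heegner
index prime to `3`, `3 ∤ [G(K) : ℤP′]`. ASSUMING ONLY Kriz–Li Thm. 1.16 (`hKL`) and modularity (`hmod`)
BY NAME: `3 ∤ [W(K) : ℤP]`. Proof: `companion_logUnit_of_index_unit` (GEN 17) then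
`padicValNat_index_eq_zero_of_companion_unit'` (GEN 16) with KL3-A from part 14's glue.
[cite: KrizLi2019, Thm. 1.16, Rem. 1.17] [cite: GrossZagier1986, §V.2 (pp. 310–312)]
[cite: Castella2018, proof of Thm. 2.3, (calcul) (arXiv:1704.06608 p. 6)] [cite: CremonaAlgorithms1997, §2.10] -/
theorem o5_index_unit_of_good_companion_heegnerIndex
    (hKL : KrizLi2019.thm116_padicLogHeegner_congruence) (hmod : exists_isNewformOf)
    (W G : WeierstrassCurve ℚ) [W.IsElliptic] [W.IsGloballyMinimal] [G.IsElliptic] [G.IsGloballyMinimal]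
    (hcong : ∀ ℓ : ℕ, ℓ.Prime → ¬ (ℓ ∣ 3 * W.conductorNorm ℤ * G.conductorNorm ℤ) →
      ((W.LFunction ℓ : ℤ) : ZMod 3) = ((G.LFunction ℓ : ℤ) : ZMod 3))
    (hρ : W.HasSurjectiveModNGaloisRep 3) (hadd : Addv W 3)
    (hunitW : ∀ ℓ ∈ klSet W G, ℓ ≠ 3 → padicValInt 3 (nsCount W ℓ) = 0)
    (hunitG : ∀ ℓ ∈ klSet G W, ℓ ≠ 3 → padicValInt 3 (nsCount G ℓ) = 0)
    (htam : ¬ 3 ∣ W.tamagawaProduct) (hgoodG : G.HasGoodReductionAtPrime 3)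
    {N N' : ℕ} [NeZero N] [NeZero N'] (D : ModularParametrizationData W N)
    (D' : ModularParametrizationData G N')
    (K : Type) [Field K] [NumberField K] (hK : IsImaginaryQuadratic K)
    (hH : SatisfiesHeegnerHypothesis N K) (hH' : SatisfiesHeegnerHypothesis N' K)
    (h3K : SatisfiesHeegnerHypothesis 3 K) (hd : NumberField.discr K < -4)
    (H : HeegnerDatum N (NumberField.discr K)) (H' : HeegnerDatum N' (NumberField.discr K))
    (ι : K →+* ℂ) (ι₃ : K →+* ℚ_[3])
    (P : (W.baseChange K).toAffine.Point) (P' Q : (G.baseChange K).toAffine.Point)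
    (hP : WeierstrassCurve.Affine.Point.map ι.toRatAlgHom P = heegnerPointComplex D H)
    (hP' : WeierstrassCurve.Affine.Point.map ι.toRatAlgHom P' = heegnerPointComplex D' H')
    (hPinf : ¬ IsOfFinAddOrder P) (hP'inf : ¬ IsOfFinAddOrder P') (hQ : ¬ IsOfFinAddOrder Q)
    (hQunit : X11b.padicLogOrd G 3 ι₃ Q + padicValInt 3 (nsCount G 3) - 1 = 0)
    (hIdx : ¬ 3 ∣ (AddSubgroup.zmultiples P').index)
    (hcD : padicValInt 3 D.maninConstant = 0) (hc3' : ¬ ((3 : ℤ) ∣ D'.maninConstant)) :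
    padicValNat 3 (AddSubgroup.zmultiples P).index = 0 := by
  haveI : Fact (Nat.Prime 3) := ⟨Nat.prime_three⟩
  have h3d : ¬ ((3 : ℤ) ∣ NumberField.discr K) := not_three_dvd_discr_of_split K hK h3K
  have hcD' : padicValInt 3 D'.maninConstant = 0 := padicValInt.eq_zero_of_not_dvd hc3'
  have hWa3 : W.LFunction 3 = 0 :=
    W.LFunction_apply_eq_zero_of_not_good_of_not_mult 3 hadd.1 hadd.2 (dvd_refl 3)
  have hNW : W.conductorNorm ℤ ≠ 0 := (W.conductorNorm_pos_holds).ne'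
  have hNG : G.conductorNorm ℤ ≠ 0 := (G.conductorNorm_pos_holds).ne'
  -- `3 ∤ index` contains the finiteness of the index (`3 ∣ 0`): no Kolyvagin input
  have hI0 : (AddSubgroup.zmultiples P').index ≠ 0 := fun h => hIdx (h ▸ dvd_zero 3)
  have hI : padicValNat 3 (AddSubgroup.zmultiples P').index = 0 := padicValNat.eq_zero_of_not_dvd hIdx
  -- companion side (GEN 17): `Q` `3`-primitive and `3 ∤ [G(K):ℤP′]` ⇒ `P′` `3`-primitive
  have hGunit : X11b.padicLogOrd G 3 ι₃ P' + padicValInt 3 (nsCount G 3) - 1 = 0 :=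
    companion_logUnit_of_index_unit G hgoodG ι₃ P' Q hP'inf hQ hI0 hI hQunit
  -- W side (GEN 16) with KL3-A := Kriz–Li Thm. 1.16 by name (part 14)
  exact padicValNat_index_eq_zero_of_companion_unit'
    (krizLiUnitBitTransportThree_of_thm116_of_exists_isNewformOf hKL hmod) W G hcong hρ hadd hWa3 hNW hNG
    hunitW hunitG htam D D' K hK hH hH' hd h3d H H' ι ι₃ P P' hP hP' hPinf hP'inf hcD hcD' hGunit

/-! ## §2 The same END with the `3`-primitive datum a RATIONAL point of the companion (part 12) -/

/-- **Heegner-index END, certificate form of the unit-log binder.** §1 with `Q`, `hQ`, `hQunit` replaced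
by a rational point `Q₀ ∈ G(ℚ)` of infinite order whose `ℤ₃`-linearly extended formal-group logarithm at
`Q₀ ⊗ ℚ₃` has valuation `1 − v₃ |G̃(𝔽₃)|` (part 12; for a supersingular companion `v₃ |G̃(𝔽₃)| = 0`, so the
condition reads: `Q₀` is not divisible by `3` in `G(ℚ₃)`). Per-row data: `hcong`, `hρ`, `hadd`, `hunitW`,
`hunitG`, `htam`, `hgoodG`, Manin units, the rational `3`-primitive point, and the companion's Heegner
index prime to `3`; published inputs Kriz–Li Thm. 1.16 and modularity BY NAME; Heegner data.
[cite: KrizLi2019, Thm. 1.16, Rem. 1.17] [cite: Castella2018, §2.2 and Thm. 2.3 (arXiv:1704.06608 p. 5)]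
[cite: GrossZagier1986, §V.2 (pp. 310–312)] -/
theorem o5_index_unit_of_good_companion_heegnerIndex_rat
    (hKL : KrizLi2019.thm116_padicLogHeegner_congruence) (hmod : exists_isNewformOf)
    (W G : WeierstrassCurve ℚ) [W.IsElliptic] [W.IsGloballyMinimal] [G.IsElliptic] [G.IsGloballyMinimal]
    (hcong : ∀ ℓ : ℕ, ℓ.Prime → ¬ (ℓ ∣ 3 * W.conductorNorm ℤ * G.conductorNorm ℤ) →
      ((W.LFunction ℓ : ℤ) : ZMod 3) = ((G.LFunction ℓ : ℤ) : ZMod 3))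
    (hρ : W.HasSurjectiveModNGaloisRep 3) (hadd : Addv W 3)
    (hunitW : ∀ ℓ ∈ klSet W G, ℓ ≠ 3 → padicValInt 3 (nsCount W ℓ) = 0)
    (hunitG : ∀ ℓ ∈ klSet G W, ℓ ≠ 3 → padicValInt 3 (nsCount G ℓ) = 0)
    (htam : ¬ 3 ∣ W.tamagawaProduct) (hgoodG : G.HasGoodReductionAtPrime 3)
    {N N' : ℕ} [NeZero N] [NeZero N'] (D : ModularParametrizationData W N)
    (D' : ModularParametrizationData G N')
    (K : Type) [Field K] [NumberField K] (hK : IsImaginaryQuadratic K)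
    (hH : SatisfiesHeegnerHypothesis N K) (hH' : SatisfiesHeegnerHypothesis N' K)
    (h3K : SatisfiesHeegnerHypothesis 3 K) (hd : NumberField.discr K < -4)
    (H : HeegnerDatum N (NumberField.discr K)) (H' : HeegnerDatum N' (NumberField.discr K))
    (ι : K →+* ℂ) (ι₃ : K →+* ℚ_[3])
    (P : (W.baseChange K).toAffine.Point) (P' : (G.baseChange K).toAffine.Point)
    (hP : WeierstrassCurve.Affine.Point.map ι.toRatAlgHom P = heegnerPointComplex D H)
    (hP' : WeierstrassCurve.Affine.Point.map ι.toRatAlgHom P' = heegnerPointComplex D' H')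
    (hPinf : ¬ IsOfFinAddOrder P) (hP'inf : ¬ IsOfFinAddOrder P')
    (Q₀ : G.toAffine.Point) (hQ₀ : ¬ IsOfFinAddOrder Q₀)
    (hQ₀unit : (padicLog (G.baseChange ℚ_[3])
        (Affine.Point.map (W' := G.toAffine) (S := ℚ) (Algebra.ofId ℚ ℚ_[3]) Q₀)).valuation +
      padicValInt 3 (nsCount G 3) - 1 = 0)
    (hIdx : ¬ 3 ∣ (AddSubgroup.zmultiples P').index)
    (hcD : padicValInt 3 D.maninConstant = 0) (hc3' : ¬ ((3 : ℤ) ∣ D'.maninConstant)) :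
    padicValNat 3 (AddSubgroup.zmultiples P).index = 0 := by
  haveI : Fact (Nat.Prime 3) := ⟨Nat.prime_three⟩
  have hQ : ¬ IsOfFinAddOrder (Affine.Point.map (W' := G.toAffine) (S := ℚ) (Algebra.ofId ℚ K) Q₀) :=
    not_isOfFinAddOrder_map_ofId G Q₀ hQ₀
  have hQunit : X11b.padicLogOrd G 3 ι₃ (Affine.Point.map (W' := G.toAffine) (S := ℚ) (Algebra.ofId ℚ K) Q₀) +
      padicValInt 3 (nsCount G 3) - 1 = 0 := by
    rw [padicLogOrd_map_ofId_eq_valuation_padicLog G 3 ι₃ Q₀ hQ₀]; exact hQ₀unit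
  exact o5_index_unit_of_good_companion_heegnerIndex hKL hmod W G hcong hρ hadd hunitW hunitG htam hgoodG D
    D' K hK hH hH' h3K hd H H' ι ι₃ P P' _ hP hP' hPinf hP'inf hQ hQunit hIdx hcD hc3'

end Summit.BirchSwinnertonDyer.Rank1Residual.O5.HeegnerLogTransport

end
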